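import Summits.Langlands.Langlands.Theses.FiniteLevelTorsionSplit
import Summits.Langlands.Langlands.Theorems.LevelOneDyadicFiniteLevel

/-!
# Route FiniteLevelTorsionSplit — the support item FL `FiniteLevelNormalForm` is PROVED

Item stmt-Langlands-26852 (support, rank 9) of route-Langlands-FiniteLevelTorsionSplit rev 0 (decomp-langlands lens-4 gen 18; child of
route-Langlands-TorsionAvatarReduction at TA 28545): «TA's dial ⇒ LA's dial for every K, n, ρ» — every mod-2 torsion avatar in the completed
Hecke algebra at full tame level occurs at ONE finite level — the hypothesis-free ENGINE R_fin of the node (`exists_levelwise`, landed as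
`Theorems/LevelOneDyadicFiniteLevelEngine.lean`, p792657) packaged as the twin theorem
`Summit.Langlands.Langlands.Theorems.LevelOneDyadic.FiniteLevel.finiteLevelNormalForm_holds` (`Theorems/LevelOneDyadicFiniteLevel.lean`, p793000).
The route decl and the twin decl are the same text (`Iff.rfl`), so the twin's proof closes the ledger item.  Nothing here proves `Langlands`.
-/

set_option linter.dupNamespace false -- project-wide option (lakefile weak.linter.dupNamespace); `Summit.Langlands.Langlands` is the mandated namespace

namespace Summit.Langlands.Langlands.Theorems

/-- The route decl FL is, verbatim, the twin's `FiniteLevelNormalForm` (kernel-checked text identity). -/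
theorem finiteLevelTorsionSplit_fl_route_iff_twin :
    Summit.Langlands.Langlands.Theses.FiniteLevelTorsionSplit.FiniteLevelNormalForm ↔
      Summit.Langlands.Langlands.Theorems.LevelOneDyadic.FiniteLevel.FiniteLevelNormalForm := Iff.rfl

/-- **FL `FiniteLevelNormalForm` (stmt-Langlands-26852) holds** — by the finite-level engine R_fin (`finiteLevelNormalForm_holds` of the twin). -/
theorem finiteLevelTorsionSplit_finiteLevelNormalForm_proof :
    Summit.Langlands.Langlands.Theses.FiniteLevelTorsionSplit.FiniteLevelNormalForm :=
  finiteLevelTorsionSplit_fl_route_iff_twin.2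
    Summit.Langlands.Langlands.Theorems.LevelOneDyadic.FiniteLevel.finiteLevelNormalForm_holds

end Summit.Langlands.Langlands.Theorems
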